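import Mathlib
import Summits.NavierStokesRegularity.OSWSelfSimilar.SheetNSLineTorusCascadeStationaryPole
import Summits.NavierStokesRegularity.OSWSelfSimilar.SheetNSLineTorusCascadeShift
import Summits.NavierStokesRegularity.OSWSelfSimilar.SheetNSLineTorusCascadeSynthesis
import HarnessLib

/-!
# Viscous CLM on the torus (`a = 0`, `σ = 2`): the stationary-pole comparison RESTARTED at any time — a windowed
# envelope plus a geometric bound at the window's end give a GLOBAL geometric envelope, hence a global classical solution

HONEST FRAMING (cell ns-blowup GROUP B «PROFILE SEARCH», zone Z3, row Z3-U addendum A-F2 of `HOME/profile/z3/CENSUS-Z3.md`;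
human rulings D-0035/D-0074): **1-D MODEL (viscous Constantin–Lax–Majda equation `ω_t = ω·Hω + ν ω_xx` on `𝕋`,
`H = hilbertTransformCircle`); ODE / series calculus, kernel-checked; not Euler, not Navier–Stokes; «violates: none — MODEL».**

WHY. The synthesis theorem `isClassicalSolution_synth` (`SheetNSLineTorusCascadeSynthesis`) turns a sine cascade with a
GLOBAL-in-time geometric envelope `|e_k(t)| ≤ A·k·q^k` (`q < 1`) into a global classical solution of the MODEL PDE; the
stationary pole gives such an envelope only for `c < 12ν` (`mode_le_stationaryPole`). The certified global side of the
threshold (`c < 19.56ν` cert5 / `c < 19.78ν` eng-5 side A) comes as an envelope on a TIME WINDOW `[0, T₀]` (moving-pole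
comparison + head tables). This file supplies the missing step: **the stationary-pole comparison can be restarted at any time
`T₀` from ANY nonnegative datum below the pole profile** — so once the modes at `T₀` sit below `12ν·k·q′^k` for some `q′ < 1`,
they stay there for all later times, and window + restart = global envelope.

* `IsNonnegCascade.mode_le_stationaryPole_of_datum` — for a nonnegative cascade with `ν > 0` and datum `e_k(0) ≤ 12νk q^k`
  (`q ≥ 0`): `e_k(t) ≤ 12νk q^k` for all `k`, `t ≥ 0` (the proof of `mode_le_stationaryPole` with a general datum: on `k ≥ 1`
  `e^{νk²t}e_k − C_k e^{νk²t}` is non-increasing, and `C_k = 12νk q^k (1 − k⁻²) ≤ 12νk q^k`);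
* `IsSineCascade.mode_le_stationaryPole_from` — restart at `T₀ ≥ 0`: `e_k(T₀) ≤ 12νk q^k` for all `k` ⇒ the same bound for
  all `t ≥ T₀` (time shift `IsSineCascade.shift_isNonnegCascade`);
* `IsSineCascade.global_envelope_of_window` — window envelope `e_k ≤ A·k·q^k` on `[0, T₀]` + restart datum at `T₀` ⇒
  `|e_k(t)| ≤ max(A, 12ν)·k·max(q, q′)^k` for all `t ≥ 0`;
* **`IsSineCascade.isClassicalSolution_of_window`**, **`exists_global_classicalSolution_of_window`** — hence (synthesis) a
  global classical solution from `−c sin x` — the kernel slot for the certified GLOBAL constants (the certificate supplies the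
  window envelope and the restart bound as checked inequalities).

bears_on: LADDER-NS N5 / zone Z3 (row Z3-U, A-F2) → N1 linear core. WHAT THIS IS NOT: not NS; no certificate is evaluated here
(the hypotheses are the certificate's job); nothing about the threshold value.
-/

noncomputable section

namespace Summit.NavierStokesRegularity.OSWSelfSimilar
namespace SheetNSLineTorusCascade

open Finset Real Set Filter MeasureTheory
open scoped Topology

variable {ν c : ℝ} {e : ℕ → ℝ → ℝ}

/-! ### The stationary pole dominates every nonnegative cascade that starts below it -/

/-- **Stationary-pole comparison from a general nonnegative datum.** For a nonnegative cascade with `ν > 0` whose datum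
satisfies `e_k(0) ≤ 12ν·k·q^k` (`q ≥ 0`): `e_k(t) ≤ 12ν·k·q^k` for every `k` and every `t ≥ 0`. [new here — MODEL] -/
theorem IsNonnegCascade.mode_le_stationaryPole_of_datum (he : IsNonnegCascade ν e) (hν : 0 < ν) {q : ℝ} (hq : 0 ≤ q)
    (h0 : ∀ k : ℕ, e k 0 ≤ 12 * ν * (k : ℝ) * q ^ k) :
    ∀ k : ℕ, ∀ t : ℝ, 0 ≤ t → e k t ≤ 12 * ν * (k : ℝ) * q ^ k := by
  intro k
  induction k using Nat.strong_induction_on with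
  | _ k ih =>
    intro t ht
    rcases Nat.eq_zero_or_pos k with hk | hk
    · rw [hk, he.zero]; simp
    · have hk0 : (0 : ℝ) < k := by exact_mod_cast hk
      set Ck : ℝ := 24 * ν ^ 2 * ((k : ℝ) ^ 3 - k) * q ^ k / (2 * ν * (k : ℝ) ^ 2) with hCk
      -- termwise domination of the convolution on (0, ∞)
      have hconv : ∀ s, 0 < s → ∑ p ∈ antidiagonal k, e p.1 s * e p.2 s
          ≤ 24 * ν ^ 2 * ((k : ℝ) ^ 3 - k) * q ^ k := by
        intro s hs
        rw [← stationaryPole_conv ν q k]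
        refine sum_le_sum fun p hp => ?_
        have hsum : p.1 + p.2 = k := mem_antidiagonal.mp hp
        rcases Nat.eq_zero_or_pos p.1 with h1 | h1
        · rw [h1, he.zero]; simp
        rcases Nat.eq_zero_or_pos p.2 with h2 | h2
        · rw [h2, he.zero]; simp
        exact mul_le_mul (ih p.1 (by omega) s hs.le) (ih p.2 (by omega) s hs.le) (he.nonneg _ s hs.le)
          (by positivity)
      have hcontw : ContinuousOn (fun s => exp (ν * (k : ℝ) ^ 2 * s) * e k s) (Ici 0) :=
        ((continuous_exp.comp (continuous_const.mul continuous_id)).continuousOn).mul (he.cont k)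
      have hanti : AntitoneOn (fun s => exp (ν * (k : ℝ) ^ 2 * s) * e k s - Ck * exp (ν * (k : ℝ) ^ 2 * s)) (Ici 0) := by
        refine antitoneOn_of_hasDerivWithinAt_nonpos
          (f' := fun s => exp (ν * (k : ℝ) ^ 2 * s) * ((1 / 2) * ∑ p ∈ antidiagonal k, e p.1 s * e p.2 s)
            - Ck * (exp (ν * (k : ℝ) ^ 2 * s) * (ν * (k : ℝ) ^ 2)))
          (convex_Ici 0) ?_ (fun s hs => ?_) (fun s hs => ?_)
        · exact hcontw.sub
            ((continuous_const.mul (continuous_exp.comp (continuous_const.mul continuous_id))).continuousOn)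
        · rw [interior_Ici] at hs ⊢
          have h2 : HasDerivAt (fun s => Ck * exp (ν * (k : ℝ) ^ 2 * s))
              (Ck * (exp (ν * (k : ℝ) ^ 2 * s) * (ν * (k : ℝ) ^ 2))) s := by
            have := ((hasDerivAt_id s).const_mul (ν * (k : ℝ) ^ 2)).exp.const_mul Ck
            simpa using this
          exact ((he.hasDerivAt_weighted k hs).sub h2).hasDerivWithinAt
        · rw [interior_Ici] at hs
          have hE : 0 < exp (ν * (k : ℝ) ^ 2 * s) := exp_pos _
          have hc' := hconv s hs
          have hid : Ck * (exp (ν * (k : ℝ) ^ 2 * s) * (ν * (k : ℝ) ^ 2))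
              = exp (ν * (k : ℝ) ^ 2 * s) * ((1 / 2) * (24 * ν ^ 2 * ((k : ℝ) ^ 3 - k) * q ^ k)) := by
            rw [hCk]; field_simp
          rw [hid, ← mul_sub, ← mul_sub]
          have : (1 / 2) * ((∑ p ∈ antidiagonal k, e p.1 s * e p.2 s) - 24 * ν ^ 2 * ((k : ℝ) ^ 3 - k) * q ^ k) ≤ 0 := by
            linarith
          exact mul_nonpos_iff.mpr (Or.inl ⟨hE.le, this⟩)
      have h := hanti (self_mem_Ici) ht ht
      simp only [mul_zero, exp_zero, mul_one] at h
      -- h : e^{νk²t} e_k t − Ck e^{νk²t} ≤ e_k 0 − Ck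
      have hE : 0 < exp (ν * (k : ℝ) ^ 2 * t) := exp_pos _
      have hE1 : 1 ≤ exp (ν * (k : ℝ) ^ 2 * t) := one_le_exp (by positivity)
      have hCk0 : 0 ≤ Ck := by
        rw [hCk]
        have : 0 ≤ (k : ℝ) ^ 3 - k := by
          have h1 : (1 : ℝ) ≤ k := by exact_mod_cast hk
          nlinarith
        positivity
      -- Ck ≤ U_k
      have hCU : Ck ≤ 12 * ν * (k : ℝ) * q ^ k := by
        rw [hCk, div_le_iff₀ (by positivity)]
        have hqk : 0 ≤ q ^ k := pow_nonneg hq k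
        nlinarith [mul_nonneg (mul_nonneg (by positivity : (0:ℝ) ≤ 24 * ν ^ 2) hk0.le) hqk]
      have ha := h0 k
      -- e_k t ≤ Ck + (e_k 0 − Ck) e^{−νk²t} ≤ U_k
      have key : exp (ν * (k : ℝ) ^ 2 * t) * e k t ≤ exp (ν * (k : ℝ) ^ 2 * t) * (12 * ν * (k : ℝ) * q ^ k) := by
        have h1 : exp (ν * (k : ℝ) ^ 2 * t) * e k t ≤ Ck * exp (ν * (k : ℝ) ^ 2 * t) + (e k 0 - Ck) := by linarith
        have h2 : Ck * exp (ν * (k : ℝ) ^ 2 * t) + (e k 0 - Ck)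
            ≤ Ck * exp (ν * (k : ℝ) ^ 2 * t) + (12 * ν * (k : ℝ) * q ^ k - Ck) := by linarith
        have h3 : Ck * exp (ν * (k : ℝ) ^ 2 * t) + (12 * ν * (k : ℝ) * q ^ k - Ck)
            ≤ exp (ν * (k : ℝ) ^ 2 * t) * (12 * ν * (k : ℝ) * q ^ k) := by
          -- (U − Ck)(1 − e^{νk²t}) ≤ 0
          nlinarith [mul_nonneg (sub_nonneg.mpr hCU) (sub_nonneg.mpr hE1)]
        linarith
      exact le_of_mul_le_mul_left key hE

/-! ### Restart at time `T₀` -/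

/-- **Restarted stationary-pole comparison.** For a sine cascade with `ν > 0`, `c ≥ 0`: if at some `T₀ ≥ 0` all modes sit below
the pole profile, `e_k(T₀) ≤ 12ν·k·q^k` (`q ≥ 0`), then `e_k(t) ≤ 12ν·k·q^k` for all `t ≥ T₀`. [new here — MODEL] -/
theorem IsSineCascade.mode_le_stationaryPole_from (he : IsSineCascade ν c e) (hν : 0 < ν) (hc : 0 ≤ c) {T₀ q : ℝ}
    (hT₀ : 0 ≤ T₀) (hq : 0 ≤ q) (hre : ∀ k : ℕ, e k T₀ ≤ 12 * ν * (k : ℝ) * q ^ k) :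
    ∀ k : ℕ, ∀ t : ℝ, T₀ ≤ t → e k t ≤ 12 * ν * (k : ℝ) * q ^ k := by
  have hsh := he.shift_isNonnegCascade hc hT₀
  have h := hsh.mode_le_stationaryPole_of_datum hν hq (fun k => by simpa using hre k)
  intro k t ht
  have := h k (t - T₀) (sub_nonneg.mpr ht)
  simpa using this

/-- **Window + restart = global geometric envelope.** If `e_k ≤ A·k·q^k` on `[0, T₀]` and `e_k(T₀) ≤ 12ν·k·q′^k` for all `k`
(`0 ≤ q, q′`), then `|e_k(t)| ≤ max(A, 12ν)·k·max(q, q′)^k` for all `t ≥ 0`. [new here — MODEL] -/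
theorem IsSineCascade.global_envelope_of_window (he : IsSineCascade ν c e) (hν : 0 < ν) (hc : 0 ≤ c) {T₀ A q q' : ℝ}
    (hT₀ : 0 ≤ T₀) (hq : 0 ≤ q) (hq' : 0 ≤ q')
    (hwin : ∀ k : ℕ, ∀ t ∈ Icc (0 : ℝ) T₀, e k t ≤ A * k * q ^ k)
    (hre : ∀ k : ℕ, e k T₀ ≤ 12 * ν * (k : ℝ) * q' ^ k) :
    ∀ k : ℕ, ∀ t : ℝ, 0 ≤ t → |e k t| ≤ max A (12 * ν) * k * (max q q') ^ k := by
  intro k t ht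
  rw [abs_of_nonneg (nonneg he hc k t ht)]
  have hk0 : (0 : ℝ) ≤ k := Nat.cast_nonneg k
  rcases le_total t T₀ with h | h
  · calc e k t ≤ A * k * q ^ k := hwin k t ⟨ht, h⟩
      _ ≤ max A (12 * ν) * k * (max q q') ^ k := by
          gcongr
          · exact le_max_left _ _
          · exact le_max_left _ _
  · calc e k t ≤ 12 * ν * (k : ℝ) * q' ^ k := he.mode_le_stationaryPole_from hν hc hT₀ hq' hre k t h
      _ ≤ max A (12 * ν) * k * (max q q') ^ k := by
          gcongr
          · exact le_max_right _ _
          · exact le_max_right _ _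

/-- **Global classical solution from a windowed certificate.** Under the hypotheses of `global_envelope_of_window` with
`q, q′ < 1`, the sine series of the cascade is a classical solution of the MODEL PDE on every horizon (`isClassicalSolution_synth`),
with datum `−c sin x` (`synthOmega_zero_eq`). [new here — MODEL] -/
theorem IsSineCascade.isClassicalSolution_of_window (he : IsSineCascade ν c e) (hν : 0 < ν) (hc : 0 ≤ c)
    {T₀ A q q' : ℝ} (hT₀ : 0 ≤ T₀) (hq : 0 ≤ q) (hq1 : q < 1) (hq' : 0 ≤ q') (hq'1 : q' < 1)
    (hwin : ∀ k : ℕ, ∀ t ∈ Icc (0 : ℝ) T₀, e k t ≤ A * k * q ^ k)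
    (hre : ∀ k : ℕ, e k T₀ ≤ 12 * ν * (k : ℝ) * q' ^ k) (T : ℝ) :
    IsClassicalSolution ν T (synthOmega e) (synthOmegaT ν e) (synthOmegaX e) (synthOmegaXX e) :=
  isClassicalSolution_synth he (le_max_of_le_right (by positivity)) (le_trans hq (le_max_left q q'))
    (max_lt hq1 hq'1) (he.global_envelope_of_window hν hc hT₀ hq hq' hwin hre) T

/-- **Existence, packaged**: under the same hypotheses there is ONE quadruple with datum `−c sin x` that is a classical solution
on `[0, T]` for every `T`. [new here — MODEL] -/
theorem IsSineCascade.exists_global_classicalSolution_of_window (he : IsSineCascade ν c e) (hν : 0 < ν) (hc : 0 ≤ c)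
    {T₀ A q q' : ℝ} (hT₀ : 0 ≤ T₀) (hq : 0 ≤ q) (hq1 : q < 1) (hq' : 0 ≤ q') (hq'1 : q' < 1)
    (hwin : ∀ k : ℕ, ∀ t ∈ Icc (0 : ℝ) T₀, e k t ≤ A * k * q ^ k)
    (hre : ∀ k : ℕ, e k T₀ ≤ 12 * ν * (k : ℝ) * q' ^ k) :
    ∃ ω ωt ωx ωxx : ℝ → ℝ → ℝ, (∀ x, ω 0 x = -c * Real.sin x) ∧ ∀ T : ℝ, IsClassicalSolution ν T ω ωt ωx ωxx :=
  ⟨_, _, _, _, synthOmega_zero_eq he, he.isClassicalSolution_of_window hν hc hT₀ hq hq1 hq' hq'1 hwin hre⟩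

end SheetNSLineTorusCascade
end Summit.NavierStokesRegularity.OSWSelfSimilar
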